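import Mathlib

/-!
# Kummer descent along the `p`-th root overring

Topic: `Literature/AlgebraicGeometry/Resolution`. The elementary descent statement behind the
normality of Kummer orders `⊕_{j<p} A · y^j / ∏ t_i^{⌊j a_i/p⌋}` (`y^p = ∏ t_i^{a_i}`) over a
regular local ring of characteristic `p`, in the abstract form in which it is used: let `A` be a
domain with fraction field `K ⊆ Ω` (`Ω` a field of characteristic `p`) and `τ_k ∈ Ω` with
`τ_k^p = t_k ∈ A` (`k < s`).

* `rootMonomials_linearIndep`: if the `t_k` are `p`-independent over `A`
  (`Σ_e c_e^p ∏ t_k^{e_k} = 0`, `0 ≤ e_k < p`, `c_e ∈ A` ⇒ `c = 0`; e.g. members of a minimal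
  system of generators of the maximal ideal of a regular local ring), then the `p^s` monomials
  `τ^e` (`0 ≤ e_k < p`) are linearly independent over `K` (clear denominators, apply Frobenius).
* `kummerDescent_of_rootOverring`: if moreover `B = A[τ] ⊆ Ω` is integrally closed and spanned
  over `A` by the monomials, and `n_0, …, n_{p-1} ∈ ℕ^s` have pairwise distinct reductions
  mod `p`, then `Σ_j κ_j^p ∏_k t_k^{n_{jk}} ∈ A` (`κ_j ∈ K`) forces
  `κ_j ∏_k t_k^{⌊n_{jk}/p⌋} ∈ A` for all `j`: `X = Σ_j κ_j τ^{n_j}` has `X^p ∈ A` and `δ X ∈ B`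
  for some `δ ∈ A ∖ 0`, so `δ^p ∣ (δX)^p` in the integrally closed domain `B` gives `δ ∣ δ X`,
  i.e. `X ∈ B` (`IsIntegrallyClosed.pow_dvd_pow_iff`); expanding `X` on the monomial basis
  (`τ^{n_j} = ∏ t_k^{⌊n_{jk}/p⌋} · τ^{n_j mod p}`) and comparing coefficients with the
  independence over `K` gives the claim.
* two bookkeeping lemmas used when the statement is applied to a concrete product
  `g = ∏ t_i^{a_i}` whose unit part is absorbed into one parameter:
  `span_range_update_mul_unit` (twisting one generator of an ideal by a unit) and
  `prod_pow_twist_reindex` (reindexing a product over a finset with one twisted factor).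

## Sources

Standard Kummer theory / `p`-bases in characteristic `p` (folklore); cf. H. Matsumura,
*Commutative Ring Theory* (1986), §26 (`p`-bases) and Thm. 19.4 (regular ⇒ normal), and the
Kummer coverings of V. Cossart, O. Piltant, J. Algebra 320 (2008), §9. Not here: the regularity
of `A[τ]` for regular parameters (`isRegularLocalRing_localization_adjoin_roots` and the
summit-side `stub_rootOverring`) and the `p`-independence of regular parameters.
-/

noncomputable section

open IsLocalRing

namespace Literature.AlgebraicGeometry.Resolution

/-- Replacing one member of a family by a unit multiple does not change the ideal the family
generates. [folklore] -/
theorem span_range_update_mul_unit {R : Type*} [CommRing R] {d : ℕ} (tw : Fin d → R)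
    (k₀ : Fin d) (w : Rˣ) :
    Ideal.span (Set.range (Function.update tw k₀ (tw k₀ * w))) = Ideal.span (Set.range tw) := by
  classical
  apply le_antisymm
  · rw [Ideal.span_le]
    rintro _ ⟨k, rfl⟩
    by_cases hk : k = k₀
    · subst hk
      rw [Function.update_self]
      exact Ideal.mul_mem_right _ _ (Ideal.subset_span ⟨k, rfl⟩)
    · rw [Function.update_of_ne hk]
      exact Ideal.subset_span ⟨k, rfl⟩
  · rw [Ideal.span_le]
    rintro _ ⟨k, rfl⟩
    by_cases hk : k = k₀
    · subst hk
      have h := Ideal.mul_mem_right (↑w⁻¹ : R) _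
        (Ideal.subset_span (s := Set.range (Function.update tw k (tw k * w))) ⟨k, rfl⟩)
      rwa [Function.update_self, Units.mul_inv_cancel_right] at h
    · have h :=
        Ideal.subset_span (s := Set.range (Function.update tw k₀ (tw k₀ * w))) ⟨k, rfl⟩
      rwa [Function.update_of_ne hk] at h

section Core

variable {A K Ω : Type*} [CommRing A] [IsDomain A] [Field K] [Algebra A K] [IsFractionRing A K]
  [Field Ω] [Algebra A Ω] [Algebra K Ω] [IsScalarTower A K Ω]

/-- **Independence of the root monomials over the fraction field.** Let `A` be a domain with
fraction field `K ⊆ Ω` (`Ω` a field of characteristic `p`), `τ_k ∈ Ω` with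
`τ_k^p = t_k ∈ A`, and assume the `p`-independence of the `t_k` over `A`:
`Σ_e c_e^p ∏ t_k^{e_k} = 0` (`0 ≤ e_k < p`, `c_e ∈ A`) forces `c = 0`. Then the monomials
`∏ τ_k^{e_k}` (`0 ≤ e_k < p`) are linearly independent over `K`: clear denominators and raise
the relation to the `p`-th power (Frobenius is additive in characteristic `p`). [folklore] -/
theorem rootMonomials_linearIndep (p : ℕ) (hp : p.Prime) [CharP Ω p] {s : ℕ}
    (t : Fin s → A) (τ : Fin s → Ω) (hτ : ∀ k, τ k ^ p = algebraMap A Ω (t k))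
    (hPI : ∀ c : (Fin s → Fin p) → A,
      ∑ e, c e ^ p * ∏ k, t k ^ (e k : ℕ) = 0 → ∀ e, c e = 0)
    (lam : (Fin s → Fin p) → K)
    (hrel : ∑ e, algebraMap K Ω (lam e) * ∏ k, τ k ^ (e k : ℕ) = 0) :
    ∀ e, lam e = 0 := by
  haveI := Fact.mk hp
  have hAK : Function.Injective (algebraMap A K) := IsFractionRing.injective A K
  have hAΩ : Function.Injective (algebraMap A Ω) := by
    rw [IsScalarTower.algebraMap_eq A K Ω]
    exact (algebraMap K Ω).injective.comp hAK
  obtain ⟨⟨D, hD⟩, hDlam⟩ :=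
    IsLocalization.exist_integer_multiples_of_finite (nonZeroDivisors A) lam
  choose μ hμ using hDlam
  have hμ' : ∀ e, algebraMap A K (μ e) = algebraMap A K D * lam e := fun e => by
    rw [hμ e, Algebra.smul_def]
  have h1 : ∑ e, algebraMap A Ω (μ e) * ∏ k, τ k ^ (e k : ℕ) = 0 := by
    have : ∑ e, algebraMap A Ω (μ e) * ∏ k, τ k ^ (e k : ℕ) =
        algebraMap A Ω D * ∑ e, algebraMap K Ω (lam e) * ∏ k, τ k ^ (e k : ℕ) := by
      rw [Finset.mul_sum]
      refine Finset.sum_congr rfl fun e _ => ?_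
      rw [← mul_assoc, IsScalarTower.algebraMap_apply A K Ω (μ e), hμ', map_mul,
        ← IsScalarTower.algebraMap_apply]
    rw [this, hrel, mul_zero]
  have hrelA : ∑ e, μ e ^ p * ∏ k, t k ^ (e k : ℕ) = 0 := by
    apply hAΩ
    rw [map_zero, map_sum]
    calc ∑ e, algebraMap A Ω (μ e ^ p * ∏ k, t k ^ (e k : ℕ))
        = ∑ e, (algebraMap A Ω (μ e) * ∏ k, τ k ^ (e k : ℕ)) ^ p := by
          refine Finset.sum_congr rfl fun e _ => ?_
          rw [map_mul, map_pow, map_prod, mul_pow, ← Finset.prod_pow]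
          congr 1
          refine Finset.prod_congr rfl fun k _ => ?_
          rw [map_pow, ← hτ]
          ring
      _ = 0 := by rw [← sum_pow_char p, h1, zero_pow hp.ne_zero]
  have hμ0 := hPI μ hrelA
  intro e
  have h := hμ' e
  rw [hμ0 e, map_zero] at h
  exact (mul_eq_zero.mp h.symm).resolve_left
    ((map_ne_zero_iff _ hAK).mpr (nonZeroDivisors.ne_zero hD))

/-- **Kummer descent, abstract form.** Let `A` be a domain with fraction field `K ⊆ Ω`
(`Ω` a field of characteristic `p`), `τ_k ∈ Ω` with `τ_k^p = t_k ∈ A` (`k < s`) such that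
the `t_k` are `p`-independent over `A`, and such that `B = A[τ_1, …, τ_s] ⊆ Ω` is an
integrally closed domain spanned over `A` by the monomials `τ^e` (`0 ≤ e_k < p`). Let
`n_j ∈ ℕ^s` (`j < p`) be exponent vectors whose reductions mod `p` are pairwise distinct. If
`κ_0, …, κ_{p-1} ∈ K` satisfy `Σ_j κ_j^p ∏_k t_k^{n_{jk}} ∈ A`, then
`κ_j ∏_k t_k^{⌊n_{jk}/p⌋} ∈ A` for every `j`. (Put `X = Σ_j κ_j τ^{n_j}`; then `X^p ∈ A`
and `δ X ∈ B` for some `δ ∈ A ∖ 0`, so `X ∈ B` as `B` is integrally closed; expand `X` on the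
monomial basis, `τ^{n_j} = (∏ t_k^{⌊n_{jk}/p⌋}) τ^{n_j mod p}`, and compare coefficients
using the independence of the monomials over `K`.) [folklore] -/
theorem kummerDescent_of_rootOverring (p : ℕ) (hp : p.Prime) [CharP Ω p] {s : ℕ}
    (t : Fin s → A) (τ : Fin s → Ω) (hτ : ∀ k, τ k ^ p = algebraMap A Ω (t k))
    (hPI : ∀ c : (Fin s → Fin p) → A,
      ∑ e, c e ^ p * ∏ k, t k ^ (e k : ℕ) = 0 → ∀ e, c e = 0)
    (hIC : IsIntegrallyClosed (Algebra.adjoin A (Set.range τ)))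
    (hspanM : Subalgebra.toSubmodule (Algebra.adjoin A (Set.range τ)) =
      Submodule.span A (Set.range fun e : Fin s → Fin p => ∏ i, τ i ^ (e i : ℕ)))
    (n : Fin p → Fin s → ℕ) (hn : ∀ j j', (∀ k, n j k % p = n j' k % p) → j = j')
    (κ : Fin p → K)
    (hκ : ∑ j, κ j ^ p * algebraMap A K (∏ k, t k ^ n j k) ∈ (algebraMap A K).range) :
    ∀ j, κ j * algebraMap A K (∏ k, t k ^ (n j k / p)) ∈ (algebraMap A K).range := by
  classical
  haveI := Fact.mk hp
  have hAK : Function.Injective (algebraMap A K) := IsFractionRing.injective A K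
  have hAΩ : Function.Injective (algebraMap A Ω) := by
    rw [IsScalarTower.algebraMap_eq A K Ω]
    exact (algebraMap K Ω).injective.comp hAK
  set B : Subalgebra A Ω := Algebra.adjoin A (Set.range τ) with hB
  have hτB : ∀ k, τ k ∈ B := fun k => Algebra.subset_adjoin ⟨k, rfl⟩
  obtain ⟨F, hF⟩ := RingHom.mem_range.mp hκ
  -- the element `X = Σ κ_j τ^{n_j}` and its `p`-th power
  set X : Ω := ∑ j, algebraMap K Ω (κ j) * ∏ k, τ k ^ n j k with hX
  have hXp : X ^ p = algebraMap A Ω F := by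
    rw [hX, sum_pow_char p, IsScalarTower.algebraMap_apply A K Ω F, hF, map_sum]
    refine Finset.sum_congr rfl fun j _ => ?_
    rw [mul_pow, map_mul, map_pow, ← IsScalarTower.algebraMap_apply, map_prod,
      ← Finset.prod_pow]
    congr 1
    refine Finset.prod_congr rfl fun k _ => ?_
    rw [map_pow, ← hτ]
    ring
  -- clearing denominators: `δ X ∈ B`
  obtain ⟨⟨δ, hδ⟩, hδκ⟩ :=
    IsLocalization.exist_integer_multiples_of_finite (nonZeroDivisors A) κ
  choose ν hν using hδκ
  have hν' : ∀ j, algebraMap A K (ν j) = algebraMap A K δ * κ j := fun j => by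
    rw [hν j, Algebra.smul_def]
  have hδ0 : algebraMap A Ω δ ≠ 0 := (map_ne_zero_iff _ hAΩ).mpr (nonZeroDivisors.ne_zero hδ)
  have hδX : algebraMap A Ω δ * X ∈ B := by
    rw [hX, Finset.mul_sum]
    refine Subalgebra.sum_mem B fun j _ => ?_
    rw [← mul_assoc, IsScalarTower.algebraMap_apply A K Ω δ, ← map_mul, ← hν',
      ← IsScalarTower.algebraMap_apply]
    exact B.mul_mem (B.algebraMap_mem _) (B.prod_mem fun k _ => B.pow_mem (hτB k) _)
  -- `X ∈ B` since `B` is integrally closed: `δ^p ∣ (δ X)^p = δ^p F` in `B`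
  obtain ⟨x, hx⟩ : ∃ x : B, (x : Ω) = X := by
    haveI := hIC
    have hdvd : algebraMap A B δ ^ p ∣ (⟨_, hδX⟩ : B) ^ p := by
      refine ⟨algebraMap A B F, Subtype.val_injective ?_⟩
      simp only [SubmonoidClass.coe_pow, MulMemClass.coe_mul, Subalgebra.coe_algebraMap]
      rw [mul_pow, hXp]
    obtain ⟨y, hy⟩ := (IsIntegrallyClosed.pow_dvd_pow_iff hp.ne_zero).mp hdvd
    refine ⟨y, mul_left_cancel₀ hδ0 ?_⟩
    have h := congrArg Subtype.val hy
    simpa only [MulMemClass.coe_mul, Subalgebra.coe_algebraMap] using h.symm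
  -- first expansion of `X`: on the monomial basis, with coefficients in `A`
  have hXmem : X ∈ Submodule.span A
      (Set.range fun e : Fin s → Fin p => ∏ i, τ i ^ (e i : ℕ)) := by
    rw [← hspanM, Subalgebra.mem_toSubmodule, ← hx]
    exact x.2
  obtain ⟨α, hα⟩ := (Submodule.mem_span_range_iff_exists_fun _).mp hXmem
  -- second expansion of `X`: reduce the exponents mod `p`
  obtain ⟨r, hr⟩ : ∃ r : Fin p → Fin s → Fin p, ∀ j k, (r j k : ℕ) = n j k % p :=
    ⟨fun j k => ⟨n j k % p, Nat.mod_lt _ hp.pos⟩, fun _ _ => rfl⟩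
  have hmono : ∀ j, ∏ k, τ k ^ n j k =
      algebraMap A Ω (∏ k, t k ^ (n j k / p)) * ∏ k, τ k ^ (r j k : ℕ) := by
    intro j
    rw [map_prod, ← Finset.prod_mul_distrib]
    refine Finset.prod_congr rfl fun k _ => ?_
    rw [hr, map_pow, ← hτ, ← pow_mul, ← pow_add, Nat.div_add_mod]
  -- the fibres of `j ↦ r j` are singletons
  have hfib : ∀ j, (Finset.univ.filter fun j' => r j' = r j) = {j} := by
    intro j
    ext j'
    simp only [Finset.mem_filter, Finset.mem_univ, true_and, Finset.mem_singleton]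
    refine ⟨fun h => hn j' j fun k => ?_, fun h => by rw [h]⟩
    rw [← hr, ← hr, h]
  -- compare the two expansions
  set lam : (Fin s → Fin p) → K := fun e =>
    algebraMap A K (α e) - ∑ j ∈ Finset.univ.filter (fun j => r j = e),
      κ j * algebraMap A K (∏ k, t k ^ (n j k / p)) with hlam
  have hsum1 : ∑ e, algebraMap K Ω (algebraMap A K (α e)) * ∏ k, τ k ^ (e k : ℕ) = X := by
    rw [← hα]
    refine Finset.sum_congr rfl fun e _ => ?_
    rw [← IsScalarTower.algebraMap_apply, Algebra.smul_def]
  have hsum2 : ∑ e, algebraMap K Ω (∑ j ∈ Finset.univ.filter (fun j => r j = e),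
      κ j * algebraMap A K (∏ k, t k ^ (n j k / p))) * ∏ k, τ k ^ (e k : ℕ) = X := by
    calc _ = ∑ e, ∑ j ∈ Finset.univ.filter (fun j => r j = e),
          algebraMap K Ω (κ j) * ∏ k, τ k ^ n j k := by
          refine Finset.sum_congr rfl fun e _ => ?_
          rw [map_sum, Finset.sum_mul]
          refine Finset.sum_congr rfl fun j hj => ?_
          rw [← (Finset.mem_filter.mp hj).2, hmono j, map_mul, ← IsScalarTower.algebraMap_apply,
            mul_assoc]
      _ = X := by rw [hX]; exact Finset.sum_fiberwise Finset.univ r _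
  have hrel : ∑ e, algebraMap K Ω (lam e) * ∏ k, τ k ^ (e k : ℕ) = 0 := by
    have : ∀ e, algebraMap K Ω (lam e) * ∏ k, τ k ^ (e k : ℕ) =
        algebraMap K Ω (algebraMap A K (α e)) * ∏ k, τ k ^ (e k : ℕ) -
          algebraMap K Ω (∑ j ∈ Finset.univ.filter (fun j => r j = e),
            κ j * algebraMap A K (∏ k, t k ^ (n j k / p))) * ∏ k, τ k ^ (e k : ℕ) := by
      intro e
      rw [hlam, map_sub, sub_mul]
    rw [Finset.sum_congr rfl fun e _ => this e, Finset.sum_sub_distrib, hsum1, hsum2, sub_self]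
  have hlam0 := rootMonomials_linearIndep p hp t τ hτ hPI lam hrel
  intro j
  have hj := hlam0 (r j)
  simp only [hlam, hfib j, Finset.sum_singleton, sub_eq_zero] at hj
  exact RingHom.mem_range.mpr ⟨α (r j), hj⟩

end Core

section Reduction

variable {A : Type*} [CommRing A]

/-- Reindexing the charged parameters. Let `S ⊆ Fin (m+1)`, `enum : Fin s ≃ S`, `i₀ ∈ S`,
and `t' : Fin s → A` with `t' k = t (enum k)` for `enum k ≠ i₀` and `t' k = t i₀ · W` for
`enum k = i₀`. Then `∏_k t'_k^{f (enum k)} = (∏_{i ∈ S} t_i^{f i}) · W^{f i₀}`. [folklore] -/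
theorem prod_pow_twist_reindex {m s : ℕ} (t : Fin (m + 1) → A) (S : Finset (Fin (m + 1)))
    (enum : Fin s ≃ {i // i ∈ S}) (i₀ : Fin (m + 1)) (hi₀ : i₀ ∈ S) (W : A)
    (t' : Fin s → A)
    (ht' : ∀ k, t' k = t (enum k) * if (enum k : Fin (m + 1)) = i₀ then W else 1)
    (f : Fin (m + 1) → ℕ) :
    ∏ k, t' k ^ f (enum k) = (∏ i ∈ S, t i ^ f i) * W ^ f i₀ := by
  classical
  have h1 : ∀ g : Fin (m + 1) → A, ∏ k, g (enum k) = ∏ i ∈ S, g i := fun g => by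
    rw [← Finset.prod_coe_sort S g]
    exact Fintype.prod_equiv enum (fun k => g (enum k)) (fun i => g i) fun _ => rfl
  simp_rw [ht', mul_pow]
  rw [Finset.prod_mul_distrib, h1 (fun i => t i ^ f i),
    h1 (fun i => (if i = i₀ then W else 1) ^ f i)]
  congr 1
  rw [Finset.prod_congr rfl fun i _ =>
    show (if i = i₀ then W else 1) ^ f i = if i = i₀ then W ^ f i else 1 by
      split_ifs <;> simp, Finset.prod_ite_eq' S i₀, if_pos hi₀]

end Reduction

end Literature.AlgebraicGeometry.Resolution

end
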